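import Summits.ValiantsHypothesis.ValiantsHypothesis.Theorems.DepthWindowLowBiasRound
import Summits.ValiantsHypothesis.ValiantsHypothesis.Theorems.DepthWindowTreeBiasBridgeAt

/-!
# Route `DepthWindow` — `ULB₂` for ALL words reduces to ONE two-level round; the iteration and its arithmetic

Cone-free theorem (decomp-valiant lens 4, g16) supporting the crux item `HomImmHardTwoOne`
(stmt-ValiantsHypothesis-30635).  `UniversalLowBiasAt 2` («`ULB₂`», `DepthWindowNodeBias`) says that every integer
word `w : Fin d → ℤ` with `|wᵢ| ≤ h`, `|Σ w| ≤ h` has a levelled tree of depth `2·log₂log₂ d + O(1)` all of whose node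
biases are `O(h)`; by `treeBiasDoor_closed_of_ULB_two` it CLOSES the tree-bias door to the A-cell
(`homImmHardAt_two_one_of_treeBiasAt`) for every unrolling constant.  g13–g15 proved it for words with few letter
values.  The g16 builder is alphabet-free and works in ROUNDS OF TWO LEVELS at scale `v` (`β = 64h`,
`ℓ = ⌊16h/v⌋`, next scale `v' = ⌊(2v−1)/ℓ⌋ ≤ 2v²/(15h)`):

* level `2i+1` EXTRACTS, from the letters of modulus `≤ v`, disjoint groups of `≤ ℓ` letters with `ℓ·|Σ| < 2v`
  (`exists_small_segment` of `DepthWindowSmallSegment`) until fewer than `ℓ` positive or fewer than `ℓ` negative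
  small letters remain; everything else is a singleton group;
* level `2i+2` REFRESHES: one group collects all leftover letters of the minority sign plus leftover letters of the
  other sign while the running sum stays positive, every other leftover letter is TRIMMED into `[−v', 0)` by the
  extracted small sums (`exists_trim`), whose one-sided drift `E` is exactly the needed resource: the demand is
  `≤ E − Σ w` while the supply is `≥ E`, so the letters that cannot be refreshed («HOLD») have total mass `≤ |Σ w|`.

This file isolates that round as ONE statement `TwoLevelRound h` (tagged `conjecture`: OPEN in the tree; complete
proof in the workshop node NODE-v16 §4, exact algorithm simulated with all inequalities asserted) and proves
sorry-free everything AROUND it: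

* `lowBiasTree_of_twoLevelRound` — the ITERATION: `r` rounds from scale `v` give a low-bias tree of depth `2r+1`
  and node bias `64h` as soon as `n·v_r + h ≤ 64h` (`v_r` = `r`-th iterate of the next-scale map), via
  `lowBiasTree_succ_of_quotient` twice per round and the star at the end;
* `iterate_nxtScale_mul_pow_le` — the SCALE ARITHMETIC: `v_r · 7^(2^r − 1) ≤ h` (doubly exponential decay);
* `universalLowBiasAt_two_of_twoLevelRound` — hence `(∀ h ≥ 1, TwoLevelRound h) → UniversalLowBiasAt 2` with
  `(B, c₁) = (64, 3)`: `J = ⌊log₂⌊log₂ d⌋⌋ + 1` rounds suffice since `d < 2^(2^J) ≤ 63·7^(2^J−1)`;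
* `treeBiasDoor_closed_of_twoLevelRound` — and then `¬ TreeBiasGrowthAt (u·2)` for every `u ≥ 1`: no word
  whatsoever feeds the A-cell through the tree-bias door (a BARRIER for the lopsided relative-rank method on the
  depth axis at product-depth `2·log₂log₂ d + O(1)`, i.e. `max_W Treebias_Δ(W) ≤ d^{O(2^{-Δ/2})}`, to be compared with
  LST 2022 Thm. 5 `d^{1/Δ^{Ω(log Δ)}}` and with the BDS 2024 lower bound `d^{≈φ^{-Δ}}` for tuned two-letter words).

References: [LimayeSrinivasanTavenas2022] CCC 2022 (LIPIcs 234:32) Thm. 5, Question 1, §1.2 «Proof of Theorem 5»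
(footnote 11: leftovers), full version ECCC TR22-090 Lemma 9, Lemma 21, Algorithm 1, Prop. 16–17;
[BhargavDuttaSaxena2024] ACM ToCT 16(4):23 Thm. 1.4, Thm. 1.7.
-/

-- layout Summits/ValiantsHypothesis/ValiantsHypothesis forces the duplicated namespace component
set_option linter.dupNamespace false

namespace Summit.ValiantsHypothesis.ValiantsHypothesis.Theorems.DepthWindow.TreeBias

open Finset Literature.Computability.AlgebraicComplexity

/-! ### The next scale and the round statement -/

/-- The next scale of the builder at node-bias budget `64h`: with `ℓ = ⌊16h/v⌋` letters per extracted group, the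
extracted sums and the trimmed values have modulus `≤ ⌊(2v−1)/ℓ⌋`. [folklore] -/
def nxtScale (h v : ℕ) : ℕ := (2 * v - 1) / (16 * h / v)

/-- The HOLD mass of a word at scale `v`: the total modulus of its letters of modulus `> v`. [folklore] -/
def holdMass {n : ℕ} (x : Fin n → ℤ) (v : ℕ) : ℤ := ∑ i ∈ univ.filter (fun i => (v : ℤ) < |x i|), |x i|

/-- **The two-level round** of the universal builder at node-bias budget `64h` (NODE-v16 §4): a word whose letters
have modulus `≤ h`, total `|Σ x| ≤ h`, and whose letters of modulus `> v` (`1 ≤ v ≤ h`) have total mass `≤ |Σ x|`,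
can be grouped TWICE — groups of `ℓ¹`-mass `≤ 64h`, then groups of the group sums with `Σ |group sum| ≤ 64h` —
so that the resulting word of double sums again has letters of modulus `≤ h` and HOLD mass `≤ |Σ x|` at the next
scale `nxtScale h v`.  OPEN in the tree (g16: complete paper proof = extraction by `exists_small_segment`, refresh
by `exists_trim`, HOLD accounting `demand ≤ E − Σx ≤ supply − Σx`; simulated with all inequalities asserted).
[cite: LimayeSrinivasanTavenas2022, Lemma 9, Lemma 21, Algorithm 1] -/
@[conjecture] def TwoLevelRound (h : ℕ) : Prop :=
  ∀ (n v : ℕ) (x : Fin n → ℤ), 1 ≤ v → v ≤ h → (∀ i, |x i| ≤ h) → |∑ i, x i| ≤ h →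
    holdMass x v ≤ |∑ i, x i| →
    ∃ (M₁ : ℕ) (c₁ : Fin n → Fin M₁), Function.Surjective c₁ ∧
      (∀ m, ∑ j ∈ univ.filter (fun j => c₁ j = m), |x j| ≤ 64 * h) ∧
      ∃ (M₂ : ℕ) (c₂ : Fin M₁ → Fin M₂), Function.Surjective c₂ ∧
        (∀ m, ∑ j ∈ univ.filter (fun j => c₂ j = m), |quotWord x c₁ j| ≤ 64 * h) ∧
        (∀ m, |quotWord (quotWord x c₁) c₂ m| ≤ h) ∧
        holdMass (quotWord (quotWord x c₁) c₂) (nxtScale h v) ≤ |∑ i, x i|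

/-! ### Scale arithmetic -/

/-- The next scale is at most the scale (indeed much smaller). [folklore] -/
theorem nxtScale_le (h v : ℕ) (hv : v ≤ h) : nxtScale h v ≤ v := by
  unfold nxtScale
  rcases Nat.eq_zero_or_pos v with rfl | hv0
  · simp
  · have hq : 2 ≤ 16 * h / v := by
      rw [Nat.le_div_iff_mul_le hv0]; nlinarith
    calc (2 * v - 1) / (16 * h / v) ≤ (2 * v - 1) / 2 := Nat.div_le_div_left hq (by norm_num)
      _ ≤ v := by omega

/-- **One round squares the relative scale**: `15h · v' ≤ 2v²` for `v ≤ h`. [folklore] -/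
theorem nxtScale_bound (h v : ℕ) (hv : v ≤ h) : 15 * h * nxtScale h v ≤ 2 * v * v := by
  unfold nxtScale
  rcases Nat.eq_zero_or_pos v with rfl | hv0
  · simp
  · set q := 16 * h / v with hq
    have hdm := Nat.div_add_mod (16 * h) v
    have hml := Nat.mod_lt (16 * h) hv0
    rw [← hq] at hdm
    -- `q·v ≥ 15h`
    have hqv : 15 * h ≤ v * q := by nlinarith
    have hq0 : 0 < q := by
      rcases Nat.eq_zero_or_pos q with h0 | h0
      · rw [h0, mul_zero] at hqv; omega
      · exact h0
    -- `nxt · q ≤ 2v − 1`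
    have hnd := Nat.div_mul_le_self (2 * v - 1) q
    calc 15 * h * ((2 * v - 1) / q) ≤ v * q * ((2 * v - 1) / q) := Nat.mul_le_mul_right _ hqv
      _ = v * ((2 * v - 1) / q * q) := by ring
      _ ≤ v * (2 * v - 1) := Nat.mul_le_mul_left _ hnd
      _ ≤ 2 * v * v := by
          have : 2 * v - 1 ≤ 2 * v := Nat.sub_le _ _
          nlinarith

/-- Iterates of the next-scale map stay below `h`. [folklore] -/
theorem iterate_nxtScale_le (h : ℕ) : ∀ r : ℕ, (nxtScale h)^[r] h ≤ h := by
  intro r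
  induction r with
  | zero => simp
  | succ r ih =>
    rw [Function.iterate_succ_apply']
    exact le_trans (nxtScale_le h _ ih) ih

/-- **Doubly exponential decay of the scale**: `v_r · 7^(2^r − 1) ≤ h`. [folklore] -/
theorem iterate_nxtScale_mul_pow_le (h : ℕ) (hh : 1 ≤ h) :
    ∀ r : ℕ, (nxtScale h)^[r] h * 7 ^ (2 ^ r - 1) ≤ h := by
  intro r
  induction r with
  | zero => simp
  | succ r ih =>
    rw [Function.iterate_succ_apply']
    set u := (nxtScale h)^[r] h with hu
    set P := 7 ^ (2 ^ r - 1) with hP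
    have huh : u ≤ h := iterate_nxtScale_le h r
    have hstep := nxtScale_bound h u huh
    -- `7^(2^(r+1) − 1) = 7 · P²`
    have hpow : 7 ^ (2 ^ (r + 1) - 1) = 7 * (P * P) := by
      have h1 : 2 ^ (r + 1) - 1 = 1 + ((2 ^ r - 1) + (2 ^ r - 1)) := by
        have := Nat.one_le_two_pow (n := r)
        rw [pow_succ]; omega
      rw [h1, pow_add, pow_one, pow_add]
    rw [hpow]
    -- `15h · (u'·7P²) ≤ 14 (uP)² ≤ 14 h²`, hence `u'·7P² ≤ h`
    have key : 15 * h * (nxtScale h u * (7 * (P * P))) ≤ 15 * h * h := by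
      calc 15 * h * (nxtScale h u * (7 * (P * P)))
          = (15 * h * nxtScale h u) * (7 * (P * P)) := by ring
        _ ≤ (2 * u * u) * (7 * (P * P)) := Nat.mul_le_mul_right _ hstep
        _ = 14 * ((u * P) * (u * P)) := by ring
        _ ≤ 14 * (h * h) := Nat.mul_le_mul_left _ (Nat.mul_le_mul ih ih)
        _ ≤ 15 * h * h := by nlinarith
    exact Nat.le_of_mul_le_mul_left key (by omega)

/-- **The round count**: with `J = ⌊log₂⌊log₂ d⌋⌋ + 1` rounds, `d · v_J + h ≤ 64h`. [folklore] -/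
theorem final_arith (d h : ℕ) (hh : 1 ≤ h) :
    d * (nxtScale h)^[Nat.log 2 (Nat.log 2 d) + 1] h + h ≤ 64 * h := by
  set J := Nat.log 2 (Nat.log 2 d) + 1 with hJ
  have hb := iterate_nxtScale_mul_pow_le h hh J
  set u := (nxtScale h)^[J] h
  set P := 7 ^ (2 ^ J - 1) with hP
  -- `d < 2^(2^J) ≤ 63 · P`
  have hm : Nat.log 2 d + 1 ≤ 2 ^ J := Nat.lt_pow_succ_log_self (by norm_num) _
  have hd : d < 2 ^ (2 ^ J) :=
    lt_of_lt_of_le (Nat.lt_pow_succ_log_self (by norm_num) d) (Nat.pow_le_pow_right (by norm_num) hm)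
  have hJ1 : 1 ≤ 2 ^ J := Nat.one_le_two_pow
  have h63 : 2 ^ (2 ^ J) ≤ 63 * P := by
    calc 2 ^ (2 ^ J) ≤ 7 ^ (2 ^ J) := Nat.pow_le_pow_left (by norm_num) _
      _ = 7 * P := by rw [hP, ← pow_succ']; congr 1; omega
      _ ≤ 63 * P := by omega
  have hdP : d ≤ 63 * P := by omega
  calc d * u + h ≤ 63 * P * u + h := by nlinarith
    _ = 63 * (u * P) + h := by ring
    _ ≤ 63 * h + h := by nlinarith
    _ = 64 * h := by ring

/-! ### The iteration -/

/-- Splitting the `ℓ¹`-mass at scale `v`: `Σ |xᵢ| ≤ n·v + holdMass`. [folklore] -/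
theorem sum_abs_le_of_holdMass {n : ℕ} (x : Fin n → ℤ) (v : ℕ) :
    ∑ i, |x i| ≤ (n : ℤ) * v + holdMass x v := by
  unfold holdMass
  rw [← sum_filter_add_sum_filter_not univ (fun i => (v : ℤ) < |x i|) (fun i => |x i|), add_comm]
  refine add_le_add ?_ le_rfl
  calc ∑ i ∈ univ.filter (fun i => ¬ (v : ℤ) < |x i|), |x i|
      ≤ ∑ _i ∈ univ.filter (fun i => ¬ (v : ℤ) < |x i|), (v : ℤ) :=
        sum_le_sum fun i hi => not_lt.1 (mem_filter.1 hi).2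
    _ = ((univ.filter (fun i => ¬ (v : ℤ) < |x i|)).card : ℤ) * v := by rw [sum_const, nsmul_eq_mul]
    _ ≤ (n : ℤ) * v := by
        refine mul_le_mul_of_nonneg_right ?_ (by positivity)
        exact_mod_cast (card_filter_le _ _).trans (card_fin n).le

/-- **The iteration.**  Under `TwoLevelRound h`: a word with letters of modulus `≤ h`, `|Σ x| ≤ h` and HOLD mass
`≤ |Σ x|` at a scale `v ≤ h` has a low-bias tree of depth `2r + 1` and node bias `64h` as soon as
`n · v_r + h ≤ 64h`, `v_r` the `r`-th iterate of `nxtScale h` from `v`. [folklore] -/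
theorem lowBiasTree_of_twoLevelRound {h : ℕ} (hh : 1 ≤ h) (hR : TwoLevelRound h) :
    ∀ (r : ℕ) {n : ℕ} (v : ℕ) (x : Fin n → ℤ), v ≤ h → (∀ i, |x i| ≤ h) → |∑ i, x i| ≤ h →
      holdMass x v ≤ |∑ i, x i| → (n : ℤ) * ((nxtScale h)^[r] v : ℕ) + h ≤ 64 * h →
      LowBiasTree x (2 * r + 1) ((64 * h : ℕ) : ℤ) := by
  intro r
  induction r with
  | zero =>
    intro n v x hv hx hsum hhold hcount
    simp only [Function.iterate_zero, id_eq] at hcount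
    have hmass : ∑ i, |x i| ≤ ((64 * h : ℕ) : ℤ) := by
      have := sum_abs_le_of_holdMass x v
      push_cast; linarith
    simpa using lowBiasTree_of_sum_abs_le hmass (Δ := 1) le_rfl
  | succ r ih =>
    intro n v x hv hx hsum hhold hcount
    rcases Nat.eq_zero_or_pos v with rfl | hv1
    · -- scale 0: the whole word already has mass ≤ |Σ x| ≤ h
      have hmass : ∑ i, |x i| ≤ ((64 * h : ℕ) : ℤ) := by
        have := sum_abs_le_of_holdMass x 0
        push_cast at this ⊢; linarith
      exact lowBiasTree_of_sum_abs_le hmass (by omega)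
    · obtain ⟨M₁, c₁, hc₁, hm₁, M₂, c₂, hc₂, hm₂, hyh, hyhold⟩ := hR n v x hv1 hv hx hsum hhold
      set y := quotWord (quotWord x c₁) c₂ with hy
      have hysum : ∑ m, y m = ∑ i, x i := by rw [hy, sum_quotWord, sum_quotWord]
      have hM₁ : M₁ ≤ n := by simpa using Fintype.card_le_of_surjective c₁ hc₁
      have hM₂ : M₂ ≤ M₁ := by simpa using Fintype.card_le_of_surjective c₂ hc₂
      have hcount' : (M₂ : ℤ) * ((nxtScale h)^[r] (nxtScale h v) : ℕ) + h ≤ 64 * h := by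
        rw [← Function.iterate_succ_apply]
        have : (M₂ : ℤ) ≤ n := by exact_mod_cast hM₂.trans hM₁
        nlinarith
      have hT : LowBiasTree y (2 * r + 1) ((64 * h : ℕ) : ℤ) :=
        ih (nxtScale h v) y ((nxtScale_le h v hv).trans hv) hyh (hysum ▸ hsum) (hysum ▸ hyhold) hcount'
      have hm₂' : ∀ m, ∑ j ∈ univ.filter (fun j => c₂ j = m), |quotWord x c₁ j| ≤ ((64 * h : ℕ) : ℤ) :=
        fun m => by push_cast; exact hm₂ m
      have hm₁' : ∀ m, ∑ j ∈ univ.filter (fun j => c₁ j = m), |x j| ≤ ((64 * h : ℕ) : ℤ) :=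
        fun m => by push_cast; exact hm₁ m
      have hT₁ : LowBiasTree (quotWord x c₁) (2 * r + 1 + 1) ((64 * h : ℕ) : ℤ) :=
        lowBiasTree_succ_of_quotient c₂ hc₂ hm₂' hT
      have hT₀ := lowBiasTree_succ_of_quotient c₁ hc₁ hm₁' hT₁
      simpa [show 2 * (r + 1) + 1 = 2 * r + 1 + 1 + 1 by ring] using hT₀

/-! ### `ULB₂` and the closed door, from the round -/

/-- **`ULB₂` from the two-level round**, with `(B, c₁) = (64, 3)`: depth `2·⌊log₂⌊log₂ d⌋⌋ + 3`, node bias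
`64h`, for EVERY integer word. [cite: LimayeSrinivasanTavenas2022, Thm. 5, Question 1] -/
theorem universalLowBiasAt_two_of_twoLevelRound (hR : ∀ h, 1 ≤ h → TwoLevelRound h) :
    UniversalLowBiasAt 2 := by
  refine ⟨64, 3, fun d w h hw hsum => ?_⟩
  rcases Nat.eq_zero_or_pos h with rfl | hh
  · -- `h = 0`: the word vanishes
    have hmass : ∑ i, |w i| ≤ ((64 * 0 : ℕ) : ℤ) := by
      have : ∀ i, |w i| = 0 := fun i => le_antisymm (by exact_mod_cast hw i) (abs_nonneg _)
      simp [this]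
    exact lowBiasTree_of_sum_abs_le hmass (by omega)
  · have hhold : holdMass w h ≤ |∑ i, w i| := by
      unfold holdMass
      rw [filter_false_of_mem fun i _ => not_lt.2 (hw i), sum_empty]
      exact abs_nonneg _
    have hT := lowBiasTree_of_twoLevelRound hh (hR h hh) (Nat.log 2 (Nat.log 2 d) + 1) h w le_rfl hw hsum
      hhold (by exact_mod_cast final_arith d h hh)
    simpa [show 2 * (Nat.log 2 (Nat.log 2 d) + 1) + 1 = 2 * Nat.log 2 (Nat.log 2 d) + 3 by ring] using hT

/-- **The door is closed by the round**: under `TwoLevelRound`, no family of words witnesses tree-bias growth at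
slope `2u` for any `u ≥ 1`, so `homImmHardAt_two_one_of_treeBiasAt` can never be fed.
[cite: BhargavDuttaSaxena2024, Thm. 1.7] -/
theorem treeBiasDoor_closed_of_twoLevelRound (hR : ∀ h, 1 ≤ h → TwoLevelRound h) {u : ℕ} (hu : 1 ≤ u) :
    ¬ TreeBiasGrowthAt (u * 2) :=
  treeBiasDoor_closed_of_ULB_two hu (universalLowBiasAt_two_of_twoLevelRound hR)

end Summit.ValiantsHypothesis.ValiantsHypothesis.Theorems.DepthWindow.TreeBias
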